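import Mathlib
import Summits.NavierStokesRegularity.NavierStokesRegularity.Theorems.EulerZoomLiouvillePowerGaugeEulerLiouvilleNeedleHoveringMember
import Summits.NavierStokesRegularity.NavierStokesRegularity.Theorems.EulerZoomLiouvillePowerGaugeEulerLiouvilleNeedleClockPast
import HarnessLib.Audit

/-!
# Crux E `EulerZoomLiouville.PowerGaugeEulerLiouville` — THE HOVERING THRESHOLD FOR PAST-EXACT MEMBERS (ROUND-39 (CR) ∘
# ROUND-38 (T_pow) ∘ (K″), shifted twin): Bernoulli oscillation exponent `θ < 2+ρ` + a hovering law ⇒ a member exactly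
# self-similar about `(T, x₀)` on a past sub-slab with a `C²` profile is trivial

Route №10 `EulerZoomLiouville` (NavierStokesRegularity), crux E = stmt-NavierStokesRegularity-19832, line `birth`, registered
residue `stub_selfSimilarC2Needle` (THE ONE STATEMENT) and the past disjunct `IsPastSelfSimilarClassical` of `stub_nonSelfSimilarRest`;
memos ROUND-38/39 of the cell `ns-regularity-ideate` (text custody nsreg-p2 g33); width seat ns-ezl-w4 g4 (LEAD queue after key
«P-CLK»).  The PAST/SHIFTED twin of ns-ezl-w2 g3's `NeedleRace.selfSimilar_ae_eq_zero_of_hoveringLawC2` (p646439, `…NeedleHoveringMember`),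
with the binder prefix of `Past.selfSimilar_ae_eq_zero_of_vorticalFastChannelC2_profile_free_past` (p645615) / `…NeedleClockPast` (p648147):
the member is exactly self-similar about `(T, x₀)` for `τ < T₁` (`T₁ ≤ 0`, `T₁ ≤ T`), with profile `(V, P)` in its own similarity
coordinates; the hypotheses `hθ`, `hosc`, `hhover` are those of p646439 VERBATIM (statements about the profile `V` alone).

* **`selfSimilar_ae_eq_zero_of_hoveringLawC2_past`** — crux hypotheses verbatim (`0 < ρ ≤ ½`) + past-exact self-similarity about
  `(T, x₀)` + `V ∈ C²` + Bernoulli oscillation `ℋ_{P′}(y) − ℋ_{P′}(y′) ≤ C r^θ` on `B̄_r` (`r ≥ 1`) for every classical pressure `P′`,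
  some `θ < 2 + ρ` + the HOVERING LAW at every strength `c′R^{2+ρ}` and scale `δ(R) = R^{−(2+ρ−θ)/4}` ⇒ `u = 0` a.e. on
  `(−∞,0) × ℝ³`.  By name: the classical profile pressure of the past member (`Past.exists_isSelfSimilarEulerProfile`), the room
  condition (`room_of_lt`), the clock reduction (`effectiveClock_of_hoveringLaw`) at every `c′ > 0`, and the past power-clock kill
  `selfSimilar_ae_eq_zero_of_subcriticalClockC2_past`.

For the skeleton (LEAD): when the hovering law becomes alternative 3 of `HasResidenceClock ρ V` (predicate body = `hosc ∧ ∀ c′ > 0,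
hhover-body` with `θ` bound existentially under `θ < 2+ρ`), the past disjunct's alternative 6 `… ∧ ContDiff ℝ 2 V ∧ HasResidenceClock ρ V`
dispatches its third case to this theorem exactly as the centred stub dispatches to p646439.
HONEST LABEL: conditional model-class stratum (the hovering law is the open clock).  WHAT THIS IS NOT: not NS, not E — 19832 is a
crux CLASS on the MODEL lattice (E/NS strata) and stays OPEN; NS regularity is NOT proved.
References: Constantin–Ignatova–Vicol arXiv:2602.17570 §3.4.2 (3.31), §3.5 [ConstantinIgnatovaVicol2026Putative]; (Chebyshev in time) [folklore].
-/

noncomputable section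

-- the summit and its single problem share the name `NavierStokesRegularity` (D-0017 nested layout)
set_option linter.dupNamespace false

open Set Filter Topology Metric Function MeasureTheory InnerProductSpace
open scoped RealInnerProductSpace NNReal ENNReal

namespace Summit.NavierStokesRegularity.NavierStokesRegularity.Theorems.PowerGaugeEulerLiouville.NeedleRace

open Literature.Analysis Literature.Analysis.FluidPDE
open Summit.NavierStokesRegularity.NavierStokesRegularity.Theorems.PowerGaugeEulerLiouville

variable {ρ T T₁ : ℝ} {V : EuclideanSpace ℝ (Fin 3) → EuclideanSpace ℝ (Fin 3)}
  {u : ℝ → EuclideanSpace ℝ (Fin 3) → EuclideanSpace ℝ (Fin 3)} {p : ℝ → EuclideanSpace ℝ (Fin 3) → ℝ}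
  {H : ℝ → EuclideanSpace ℝ (Fin 3) → EuclideanSpace ℝ (Fin 3) →L[ℝ] EuclideanSpace ℝ (Fin 3)} {c : ℝ≥0}
  {P : EuclideanSpace ℝ (Fin 3) → ℝ}

/-- **THE HOVERING THRESHOLD AT MEMBER LEVEL, PAST-EXACT TWIN (ROUND-39 (CR) ∘ (T_pow) ∘ (K″)).**  Crux hypotheses verbatim
(`0 < ρ ≤ ½`) + exact self-similarity about `(T, x₀)` for `τ < T₁` (`T₁ ≤ 0`, `T₁ ≤ T`) + a `C²` velocity profile `V` with Bernoulli
oscillation exponent `θ < 2 + ρ` (for every classical pressure of the profile) carrying the HOVERING LAW at every strength `c′R^{2+ρ}`,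
scale `δ(R) = R^{−(2+ρ−θ)/4}` (the hypotheses `hθ`, `hosc`, `hhover` of `selfSimilar_ae_eq_zero_of_hoveringLawC2` verbatim) ⇒ `u = 0`
a.e. on `(−∞,0) × ℝ³`. [cite: ConstantinIgnatovaVicol2026Putative, §3.4.2 eq. (3.31)] -/
theorem selfSimilar_ae_eq_zero_of_hoveringLawC2_past (hρ : 0 < ρ) (hρh : ρ ≤ 1 / 2) (hT₁ : T₁ ≤ 0) (hTT₁ : T₁ ≤ T)
    (x₀ : EuclideanSpace ℝ (Fin 3))
    (hsw : IsSuitableWeakSolutionOn (slab (EuclideanSpace ℝ (Fin 3)) (Iio 0) isOpen_Iio) 0 0 u p)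
    (hH : HasWeakSpatialGradientOn (slab (EuclideanSpace ℝ (Fin 3)) (Iio 0) isOpen_Iio) u H)
    (hgauge : ∀ a : ℝ, 0 < a →
      ENNReal.ofReal (a ^ (2 * ρ)) * cknA a (0 : ℝ × EuclideanSpace ℝ (Fin 3)) u +
          ENNReal.ofReal (a ^ ρ) * cknE a (0 : ℝ × EuclideanSpace ℝ (Fin 3)) H +
        ENNReal.ofReal (a ^ (2 * ρ)) * cknD a (0 : ℝ × EuclideanSpace ℝ (Fin 3)) p ≤ (c : ℝ≥0∞))
    (hu : ∀ τ : ℝ, τ < T₁ → u τ = fun x => selfSimilarCollapse (1 / (2 + ρ)) T V τ (x - x₀))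
    (hp : ∀ τ : ℝ, τ < T₁ → p τ = fun x => selfSimilarCollapsePressure (1 / (2 + ρ)) T P τ (x - x₀))
    (hV : ContDiff ℝ 2 V) {θ : ℝ} (hθ : θ < 2 + ρ)
    (hosc : ∀ P' : EuclideanSpace ℝ (Fin 3) → ℝ, IsSelfSimilarEulerProfile (1 / (2 + ρ)) 0 V P' →
      ∃ C : ℝ, ∀ r : ℝ, 1 ≤ r → ∀ y y' : EuclideanSpace ℝ (Fin 3), ‖y‖ ≤ r → ‖y'‖ ≤ r →
        selfSimilarBernoulli (1 / (2 + ρ)) 0 V P' y - selfSimilarBernoulli (1 / (2 + ρ)) 0 V P' y' ≤ C * r ^ θ)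
    (hhover : ∀ c' : ℝ, 0 < c' → ∀ x₀ : EuclideanSpace ℝ (Fin 3), curl V x₀ ≠ 0 → ∃ r : ℝ, 0 < r ∧ ∃ R₀ : ℝ,
      ∀ R : ℝ, R₀ ≤ R → ∀ (V' : EuclideanSpace ℝ (Fin 3) → EuclideanSpace ℝ (Fin 3)) (K Rbig : ℝ), ContDiff ℝ 2 V' →
        (∀ y, ‖fderiv ℝ V' y‖ ≤ K) → 2 * R < Rbig → (∀ w ∈ ball (0 : EuclideanSpace ℝ (Fin 3)) Rbig, V' w = V w) →
        (volume (ball x₀ r ∩ {a | ∀ σ ∈ Icc 0 (c' * R ^ (2 + ρ)),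
            ‖ODE.evolutionMap (fun _ : ℝ => selfSimilarTransport (1 / (2 + ρ)) 0 V') 0 (-σ) a‖ ≤ 2 * R} ∩
          {a | c' * R ^ (2 + ρ) / 2 ≤ (volume {σ ∈ Icc 0 (c' * R ^ (2 + ρ)) |
            ‖selfSimilarTransport (1 / (2 + ρ)) 0 V'
                (ODE.evolutionMap (fun _ : ℝ => selfSimilarTransport (1 / (2 + ρ)) 0 V') 0 (-σ) a)‖ <
              R ^ (-((2 + ρ - θ) / 4))}).toReal})).toReal ≤ (volume (ball x₀ r)).toReal / 4) :
    uncurry u =ᵐ[volume.restrict (Iio (0 : ℝ) ×ˢ (univ : Set (EuclideanSpace ℝ (Fin 3))))] 0 := by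
  -- adapted from `selfSimilar_ae_eq_zero_of_hoveringLawC2` (…NeedleHoveringMember, ns-ezl-w2 g3): the classical pressure of the
  -- `C²` profile now comes from the far-past extension (`Past.exists_isSelfSimilarEulerProfile`)
  have h2ρ : (0 : ℝ) < 2 + ρ := by linarith
  have hγ2 : 1 / (2 + ρ) < 1 / 2 := one_div_lt_one_div_of_lt two_pos (by linarith)
  obtain ⟨P', hprof⟩ := Past.exists_isSelfSimilarEulerProfile hρ hT₁ hTT₁ hsw.distributional hu hp hV
  obtain ⟨C, hoscC⟩ := hosc P' hprof
  have hC0 : 0 ≤ C := nonneg_of_bernoulliOsc hoscC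
  -- the clock at every strength `c′ R^{2+ρ}` by the clock reduction, then the past power-clock kill
  refine selfSimilar_ae_eq_zero_of_subcriticalClockC2_past hρ hρh hT₁ hTT₁ x₀ hsw hH hgauge hu hp hV (fun c' hc' => ?_)
  have h12 : 0 < 1 - 2 * (1 / (2 + ρ)) := by linarith
  obtain ⟨R₁, hR₁⟩ := room_of_lt (ρ := ρ) hθ hC0 (mul_pos h12 hc')
  have hroom : ∃ R₁ : ℝ, ∀ R : ℝ, R₁ ≤ R →
      (2 : ℝ) ^ (2 + θ) * C * R ^ θ ≤ (1 - 2 * (1 / (2 + ρ))) * c' * (R ^ (-((2 + ρ - θ) / 4))) ^ 2 * R ^ (2 + ρ) :=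
    ⟨max R₁ 1, fun R hR => by
      have h := hR₁ R ((le_max_left _ _).trans hR)
      linarith [h]⟩
  exact effectiveClock_of_hoveringLaw (e := 2 + ρ) hprof hγ2 hc' hoscC
    (fun R hR => Real.rpow_pos_of_pos (by linarith) _) hroom (hhover c' hc')

end Summit.NavierStokesRegularity.NavierStokesRegularity.Theorems.PowerGaugeEulerLiouville.NeedleRace

end
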